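import Mathlib
import HarnessLib

/-!
# Hexagon normal form — THE HEXAGON CUBIC LEMMA (port of the route owner's kernel certificate `l15/HexagonCubic.lean`)

Support lemma toward the OPEN finite-type hexagon conjecture behind crux `stmt-QuantumFields-23125`
(`F4SubCurvatureDoor.RationalToGeneral`; crux idea card `hexagon-normal-form` of planner `ym-idea-3` g15; definitions in
`F4SubCurvatureDoorHexagonNormalFormDefs.lean`, p660858).

On a short-root (60°) plane the top-degree balance of the hexagon pencil `Φ_s = F + P_s G` at scale `w = λ s`, in the case
`deg F = deg G + 3`, is the HEXAGON CUBIC `Q_a(λ) = a λ³ − 18 λ² + 48 λ − 32`, `a ≠ 0` the ratio of the top coefficients.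
The Wick condition on that plane needs ALL THREE roots real and `≤ 1`.  This file proves that this never happens:

* `hexagonCubic_vieta`, `hexagonCubic_root_neg` — Vieta from a pointwise factorisation; for `a < 0` a root `≤ 1` is negative
  (`a λ³ = 18 (λ − 4/3)²` on `[0, 1]` is impossible);
* `hexagonCubic_no_three_roots_le_one` — THE HEXAGON CUBIC LEMMA (real form): `a λ³ − 18 λ² + 48 λ − 32` (`a ≠ 0`) never factors as
  `a (λ − l₁)(λ − l₂)(λ − l₃)` with `l₁, l₂, l₃ ≤ 1` (`a < 0`: all roots negative, so `e₂ > 0`, against `a e₂ = 48`; `a > 0`: `e₁ ≤ 3`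
  forces `a ≥ 6` while reality `e₁² ≥ 3 e₂` forces `a ≤ 9/4`);
* `hexagonCubic_exists_root_not_wick` — COMPLEX form, the shape consumed by the rescaling principle `rescaled_roots_mem`
  (`F4SubCurvatureDoorHexagonPolynomial.lean`, p675022): for real `a ≠ 0` the cubic has a complex root OUTSIDE the closed Wick set
  `{Im w = 0, Re w ≤ 1}` (the complex cubic splits over `ℂ`; if all three roots were real `≤ 1` the real form would be contradicted);
  `hexagonCubic_exists_root_not_wick₂` — the same for `α w³ − 18 β w² + 48 β w − 32 β`, `α, β ≠ 0`;
  `hexagonCubicLimit_not_wick` — the same for the limit polynomial `X^g · (α X³ − 18 β X² + 48 β X − 32 β) ∈ ℝ[X]` of case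
  `deg F = deg G + 3`, `lc F ≠ −lc G` of the hexagon pencil, stated as «all complex `aeval`-roots in the Wick set ⇒ `False`»;
* `hexagonCubic_discriminant`, `hexagonCubic_boundary`, `hexagonCubic_at_one` — the memo's identities: `disc(Q_a) = 27648·a·(2 − a)`,
  `Q_2 = 2(λ−1)(λ−4)²` (boundary case: roots `1, 4, 4`), `Q_a(1) = a − 2`;
* `hexagonSquare_two_roots_le_one` — CONTRAST (square, 90°): `a λ² − 8 λ + 8` with `a = −2` DOES have both roots real `≤ 1`
  (`−2 ± 2√2`) — the one-variable shadow of Prop. B (`SquareAnalogueFails`).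

Mathlib only; THEOREMS ONLY; no `sorry`; default heartbeats.  The real-form proofs are the owner's certificate verbatim
(namespace `YMIdea3.HexagonCubic` of `l15/HexagonCubic.lean`), renamed into the tree's hexagon namespace; the complex forms are new.
HONEST LABEL: nothing about crux 23125, crux 23035, the conjecture `FiniteTypeHexagon`, any LADDER-YM rung or the Yang–Mills mass gap
is proved here.  Free-hands width seat `ym-line-sfw-p2-w4` g19 (cell `ym-idea-1`), `--supports stmt-QuantumFields-23125`, answering
`ym-line-frs-p2` g10's request (case (iii) of the polynomial hexagon pencil).
-/

set_option autoImplicit false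

open Polynomial

namespace Summit.QuantumFields.YangMills.Cruxes.RationalToGeneral.HexagonNormalForm

/-! ## Real form (the owner's certificate) -/

/-- Vieta's relations for the hexagon cubic from a pointwise factorisation
`a x³ − 18 x² + 48 x − 32 = a (x − l₁)(x − l₂)(x − l₃)`: `a e₁ = 18`, `a e₂ = 48`, `a e₃ = 32`. [folklore] -/
theorem hexagonCubic_vieta (a l₁ l₂ l₃ : ℝ)
    (hQ : ∀ x : ℝ, a * x ^ 3 - 18 * x ^ 2 + 48 * x - 32 = a * (x - l₁) * (x - l₂) * (x - l₃)) :
    a * (l₁ + l₂ + l₃) = 18 ∧ a * (l₁ * l₂ + l₁ * l₃ + l₂ * l₃) = 48 ∧ a * (l₁ * l₂ * l₃) = 32 := by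
  have h0 := hQ 0
  have h1 := hQ 1
  have h2 := hQ (-1)
  refine ⟨?_, ?_, ?_⟩
  · linear_combination (1/2 : ℝ) * h1 + (1/2 : ℝ) * h2 - h0
  · linear_combination (-1/2 : ℝ) * h1 + (1/2 : ℝ) * h2
  · linear_combination h0

/-- For `a < 0`, a root `l ≤ 1` of the hexagon cubic `a l³ − 18 l² + 48 l − 32` is negative
(on `[0, 1]` one would have `a l³ = 18 (l − 4/3)² ≥ 0`). [folklore] -/
theorem hexagonCubic_root_neg (a l : ℝ) (ha : a < 0) (hl : l ≤ 1)
    (hroot : a * l ^ 3 - 18 * l ^ 2 + 48 * l - 32 = 0) : l < 0 := by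
  by_contra h
  rw [not_lt] at h
  have h3 : 0 ≤ l ^ 3 := pow_nonneg h 3
  have hal : a * l ^ 3 ≤ 0 := by nlinarith
  nlinarith [sq_nonneg (3 * l - 4)]

/-- **The hexagon cubic lemma (real form).**  For `a ≠ 0` the cubic `a λ³ − 18 λ² + 48 λ − 32` never has three real roots
all `≤ 1`: no pointwise factorisation `a (λ − l₁)(λ − l₂)(λ − l₃)` with `l₁, l₂, l₃ ≤ 1` exists
(`a < 0`: every root is negative, so `e₂ > 0`, contradicting `a e₂ = 48`; `a > 0`: `e₁ ≤ 3` forces `a ≥ 6` while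
`e₁² ≥ 3 e₂` forces `a ≤ 9/4`). [folklore] -/
theorem hexagonCubic_no_three_roots_le_one (a l₁ l₂ l₃ : ℝ) (ha : a ≠ 0)
    (hQ : ∀ x : ℝ, a * x ^ 3 - 18 * x ^ 2 + 48 * x - 32 = a * (x - l₁) * (x - l₂) * (x - l₃)) :
    ¬ (l₁ ≤ 1 ∧ l₂ ≤ 1 ∧ l₃ ≤ 1) := by
  rintro ⟨h₁, h₂, h₃⟩
  obtain ⟨e1, e2, _⟩ := hexagonCubic_vieta a l₁ l₂ l₃ hQ
  rcases lt_or_gt_of_ne ha with hneg | hpos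
  · -- a < 0: every root is negative, hence e₂ > 0, contradicting a·e₂ = 48
    have r₁ : a * l₁ ^ 3 - 18 * l₁ ^ 2 + 48 * l₁ - 32 = 0 := by rw [hQ l₁]; ring
    have r₂ : a * l₂ ^ 3 - 18 * l₂ ^ 2 + 48 * l₂ - 32 = 0 := by rw [hQ l₂]; ring
    have r₃ : a * l₃ ^ 3 - 18 * l₃ ^ 2 + 48 * l₃ - 32 = 0 := by rw [hQ l₃]; ring
    have n₁ := hexagonCubic_root_neg a l₁ hneg h₁ r₁
    have n₂ := hexagonCubic_root_neg a l₂ hneg h₂ r₂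
    have n₃ := hexagonCubic_root_neg a l₃ hneg h₃ r₃
    have hpos2 : 0 < l₁ * l₂ + l₁ * l₃ + l₂ * l₃ := by
      nlinarith [mul_pos_of_neg_of_neg n₁ n₂, mul_pos_of_neg_of_neg n₁ n₃, mul_pos_of_neg_of_neg n₂ n₃]
    nlinarith
  · -- a > 0: e₁ ≤ 3 forces a ≥ 6, while reality (e₁² ≥ 3 e₂) forces a ≤ 9/4
    have hsum : l₁ + l₂ + l₃ ≤ 3 := by linarith
    have ha6 : 6 ≤ a := by nlinarith
    have hreal : 3 * (l₁ * l₂ + l₁ * l₃ + l₂ * l₃) ≤ (l₁ + l₂ + l₃) ^ 2 := by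
      nlinarith [sq_nonneg (l₁ - l₂), sq_nonneg (l₁ - l₃), sq_nonneg (l₂ - l₃)]
    -- multiply by a² > 0: 3·48·a ≤ 18² ⇒ a ≤ 9/4
    have key : 3 * (a * (l₁ * l₂ + l₁ * l₃ + l₂ * l₃)) * a ≤ (a * (l₁ + l₂ + l₃)) ^ 2 := by
      have hsq : (a * (l₁ + l₂ + l₃)) ^ 2 = a ^ 2 * (l₁ + l₂ + l₃) ^ 2 := by ring
      rw [hsq]
      have h3 : 3 * (a * (l₁ * l₂ + l₁ * l₃ + l₂ * l₃)) * a = a ^ 2 * (3 * (l₁ * l₂ + l₁ * l₃ + l₂ * l₃)) := by ring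
      rw [h3]
      exact mul_le_mul_of_nonneg_left hreal (sq_nonneg a)
    rw [e1, e2] at key
    nlinarith

/-- The discriminant identity recorded in the memo: `disc(a λ³ − 18 λ² + 48 λ − 32) = 27648 · a · (2 − a)`
(the general cubic discriminant `18abcd − 4b³d + b²c² − 4ac³ − 27a²d²` at `(b, c, d) = (−18, 48, −32)`). [folklore] -/
theorem hexagonCubic_discriminant (a : ℝ) :
    18 * a * (-18) * 48 * (-32) - 4 * (-18) ^ 3 * (-32) + (-18) ^ 2 * 48 ^ 2 - 4 * a * 48 ^ 3 - 27 * a ^ 2 * (-32) ^ 2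
      = 27648 * a * (2 - a) := by
  ring

/-- The boundary case `a = 2`: `2 λ³ − 18 λ² + 48 λ − 32 = 2 (λ − 1)(λ − 4)²` (roots `1, 4, 4`). [folklore] -/
theorem hexagonCubic_boundary (x : ℝ) : 2 * x ^ 3 - 18 * x ^ 2 + 48 * x - 32 = 2 * (x - 1) * (x - 4) ^ 2 := by
  ring

/-- The value at `λ = 1`: `Q_a(1) = a − 2`. [folklore] -/
theorem hexagonCubic_at_one (a : ℝ) : a * (1 : ℝ) ^ 3 - 18 * (1 : ℝ) ^ 2 + 48 * 1 - 32 = a - 2 := by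
  ring

/-- CONTRAST (square, 90°): `a λ² − 8 λ + 8` at `a = −2`, i.e. `−2 λ² − 8 λ + 8 = −2 (λ² + 4 λ − 4)`, has the two real roots
`−2 ± 2√2`, both `≤ 1` — the square analogue of the hexagon cubic lemma FAILS (one-variable shadow of `SquareAnalogueFails`).
[folklore] -/
theorem hexagonSquare_two_roots_le_one : ∃ l₁ l₂ : ℝ, l₁ ≤ 1 ∧ l₂ ≤ 1 ∧
    ∀ x : ℝ, -2 * x ^ 2 - 8 * x + 8 = -2 * (x - l₁) * (x - l₂) := by
  refine ⟨-2 + 2 * Real.sqrt 2, -2 - 2 * Real.sqrt 2, ?_, ?_, ?_⟩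
  · have h2 : Real.sqrt 2 ≤ 3 / 2 := by
      rw [show (3 / 2 : ℝ) = Real.sqrt (9 / 4) by
        rw [show (9 / 4 : ℝ) = (3 / 2) ^ 2 by norm_num, Real.sqrt_sq (by norm_num)]]
      exact Real.sqrt_le_sqrt (by norm_num)
    linarith
  · have := Real.sqrt_nonneg 2
    linarith
  · intro x
    have hs : Real.sqrt 2 ^ 2 = 2 := Real.sq_sqrt (by norm_num)
    linear_combination (-8 : ℝ) * hs

/-! ## Complex form (the shape consumed by the rescaling principle) -/

/-- **The hexagon cubic lemma (complex form).**  For real `a ≠ 0` the cubic `a w³ − 18 w² + 48 w − 32` has a complex root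
OUTSIDE the closed Wick set `{Im w = 0, Re w ≤ 1}`: over `ℂ` the cubic splits, and if all three roots were real and `≤ 1`
the real form `hexagonCubic_no_three_roots_le_one` would be contradicted. [folklore] -/
theorem hexagonCubic_exists_root_not_wick (a : ℝ) (ha : a ≠ 0) :
    ∃ w : ℂ, (a : ℂ) * w ^ 3 - 18 * w ^ 2 + 48 * w - 32 = 0 ∧ ¬ (w.im = 0 ∧ w.re ≤ 1) := by
  classical
  by_contra! hcon
  -- the complex cubic and its splitting
  set p : ℂ[X] := C (a : ℂ) * X ^ 3 + C (-18) * X ^ 2 + C 48 * X + C (-32) with hp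
  have ha' : (a : ℂ) ≠ 0 := Complex.ofReal_ne_zero.2 ha
  have hpdeg : p.natDegree = 3 := natDegree_cubic ha'
  have hplc : p.leadingCoeff = a := leadingCoeff_cubic ha'
  have hp0 : p ≠ 0 := by
    intro h
    rw [h, natDegree_zero] at hpdeg
    exact absurd hpdeg (by norm_num)
  have heval : ∀ w : ℂ, p.eval w = (a : ℂ) * w ^ 3 - 18 * w ^ 2 + 48 * w - 32 := by
    intro w
    rw [hp]
    simp only [eval_add, eval_mul, eval_C, eval_pow, eval_X]
    ring
  have hsplit : p.Splits := IsAlgClosed.splits p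
  have hcard : p.roots.card = 3 := by rw [← hsplit.natDegree_eq_card_roots, hpdeg]
  obtain ⟨z₁, z₂, z₃, hroots⟩ := Multiset.card_eq_three.1 hcard
  -- every root lies in the Wick set
  have hmem : ∀ z ∈ p.roots, z.im = 0 ∧ z.re ≤ 1 := by
    intro z hz
    have hr : p.IsRoot z := (mem_roots hp0).1 hz
    exact hcon z (by rw [← heval]; exact hr)
  have h1 := hmem z₁ (by rw [hroots]; simp)
  have h2 := hmem z₂ (by rw [hroots]; simp)
  have h3 := hmem z₃ (by rw [hroots]; simp)
  obtain ⟨l₁, rfl⟩ : ∃ l : ℝ, (l : ℂ) = z₁ := ⟨z₁.re, Complex.ext (by simp) (by simp [h1.1])⟩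
  obtain ⟨l₂, rfl⟩ : ∃ l : ℝ, (l : ℂ) = z₂ := ⟨z₂.re, Complex.ext (by simp) (by simp [h2.1])⟩
  obtain ⟨l₃, rfl⟩ : ∃ l : ℝ, (l : ℂ) = z₃ := ⟨z₃.re, Complex.ext (by simp) (by simp [h3.1])⟩
  -- the factorisation, evaluated at real points, is a real factorisation
  have hfac : ∀ x : ℝ, a * x ^ 3 - 18 * x ^ 2 + 48 * x - 32 = a * (x - l₁) * (x - l₂) * (x - l₃) := by
    intro x
    have he := hsplit.eval_eq_prod_roots (x : ℂ)
    rw [heval, hplc, hroots] at he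
    simp only [Multiset.insert_eq_cons, Multiset.map_cons, Multiset.map_singleton, Multiset.prod_cons,
      Multiset.prod_singleton] at he
    apply Complex.ofReal_injective
    push_cast
    linear_combination he
  have hl₁ : l₁ ≤ 1 := by simpa using h1.2
  have hl₂ : l₂ ≤ 1 := by simpa using h2.2
  have hl₃ : l₃ ≤ 1 := by simpa using h3.2
  exact hexagonCubic_no_three_roots_le_one a l₁ l₂ l₃ ha hfac ⟨hl₁, hl₂, hl₃⟩

/-- The hexagon cubic lemma, complex form with two top coefficients: for real `α ≠ 0`, `β ≠ 0` the cubic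
`α w³ − 18 β w² + 48 β w − 32 β` has a complex root outside the Wick set `{Im w = 0, Re w ≤ 1}` (divide by `β`: `a = α/β`).
[folklore] -/
theorem hexagonCubic_exists_root_not_wick₂ (α β : ℝ) (hα : α ≠ 0) (hβ : β ≠ 0) :
    ∃ w : ℂ, (α : ℂ) * w ^ 3 - 18 * (β : ℂ) * w ^ 2 + 48 * (β : ℂ) * w - 32 * (β : ℂ) = 0 ∧ ¬ (w.im = 0 ∧ w.re ≤ 1) := by
  obtain ⟨w, hw, hbad⟩ := hexagonCubic_exists_root_not_wick (α / β) (div_ne_zero hα hβ)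
  refine ⟨w, ?_, hbad⟩
  have hβ' : (β : ℂ) ≠ 0 := Complex.ofReal_ne_zero.2 hβ
  have key : (α : ℂ) * w ^ 3 - 18 * (β : ℂ) * w ^ 2 + 48 * (β : ℂ) * w - 32 * (β : ℂ) =
      (β : ℂ) * (((α / β : ℝ) : ℂ) * w ^ 3 - 18 * w ^ 2 + 48 * w - 32) := by
    push_cast
    field_simp
  rw [key, hw, mul_zero]

/-- The hexagon cubic lemma for the LIMIT POLYNOMIAL of the hexagon pencil in the case `deg F = deg G + 3`, `lc F ≠ −lc G`
(`α = lc F + lc G`, `β = lc G`, `g = deg G`): the real polynomial `α X^{g+3} − 18 β X^{g+2} + 48 β X^{g+1} − 32 β X^g`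
(`α, β ≠ 0`) cannot have all its complex roots in the Wick set `{Im w = 0, Re w ≤ 1}` — the conclusion shape of the rescaling
principle `rescaled_roots_mem`. [folklore] -/
theorem hexagonCubicLimit_not_wick (α β : ℝ) (hα : α ≠ 0) (hβ : β ≠ 0) (g : ℕ)
    (h : ∀ w : ℂ, Polynomial.aeval w (C α * X ^ (g + 3) - C (18 * β) * X ^ (g + 2) + C (48 * β) * X ^ (g + 1) -
      C (32 * β) * X ^ g : ℝ[X]) = 0 → w.im = 0 ∧ w.re ≤ 1) : False := by
  obtain ⟨w, hw, hbad⟩ := hexagonCubic_exists_root_not_wick₂ α β hα hβ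
  refine hbad (h w ?_)
  simp only [map_sub, map_add, map_mul, map_pow, Polynomial.aeval_X, Polynomial.aeval_C, Complex.coe_algebraMap]
  push_cast
  have key : (α : ℂ) * w ^ (g + 3) - 18 * (β : ℂ) * w ^ (g + 2) + 48 * (β : ℂ) * w ^ (g + 1) - 32 * (β : ℂ) * w ^ g =
      w ^ g * ((α : ℂ) * w ^ 3 - 18 * (β : ℂ) * w ^ 2 + 48 * (β : ℂ) * w - 32 * (β : ℂ)) := by ring
  rw [key, hw, mul_zero]

/-- The hexagon cubic lemma for the limit polynomial in PRODUCT form `C c · X^g · (C a · X³ − C 18 · X² + C 48 · X − C 32)`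
(`a ≠ 0`; the hypothesis `c ≠ 0` is carried only to match the consumer — the bad root kills the cubic factor for every `c`;
in the pencil `c = lc G`, `a = (lc F + lc G)/lc G`, `g = deg G`): NOT all of its complex `aeval`-roots lie in the
Wick set `{Im w = 0, Re w ≤ 1}` — verbatim the negation of the conclusion of `hexagonPencil_cubic_limit`
(`F4SubCurvatureDoorHexagonPolynomialCubicCase.lean`), so case (iii) `deg F = deg G + 3`, `lc F ≠ −lc G` of
«no polynomial pair passes the hexagon Wick test» closes by one application. [folklore] -/
theorem hexagonCubicProduct_not_wick (c a : ℝ) (g : ℕ) (_hc : c ≠ 0) (ha : a ≠ 0) :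
    ¬ ∀ w : ℂ, Polynomial.aeval w (C c * X ^ g * (C a * X ^ 3 - C 18 * X ^ 2 + C 48 * X - C 32) : ℝ[X]) = 0 →
      w ∈ {w : ℂ | w.im = 0 ∧ w.re ≤ 1} := by
  intro h
  obtain ⟨w, hw, hbad⟩ := hexagonCubic_exists_root_not_wick a ha
  refine hbad (h w ?_)
  simp only [map_sub, map_add, map_mul, map_pow, Polynomial.aeval_X, Polynomial.aeval_C, Complex.coe_algebraMap]
  push_cast
  rw [hw, mul_zero]

end Summit.QuantumFields.YangMills.Cruxes.RationalToGeneral.HexagonNormalForm
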